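import Mathlib
import HarnessLib
import Summits.HodgeConjecture.HodgeConjecture.Theses.KleimanBFSeeds
import Summits.HodgeConjecture.HodgeConjecture.Theorems.VHCAbelianSchemesRoadSecantQuotientAnchorPinnedWeilPlane
import Literature.AlgebraicGeometry.Motives.SegreHyperplaneClass
import Literature.AlgebraicGeometry.HodgeTheory.WeilClassesBFSheafSeedAt
import Literature.AlgebraicGeometry.HodgeTheory.WeilClassesBlochSeed
import Literature.AlgebraicGeometry.HodgeTheory.HodgeRiemannDegreeOne

/-!
# K2 `KleimanSemiregularAnchor` (stmt-HodgeConjecture-25931): NO JUNK EXITS for the seed shape —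
# the sheaf of a class design / Buchweitz–Flenner sheaf seed is never zero, and never of rank `≤ 1` once `1 ∈ I`

HONEST FRAMING: a NEGATIVE bookkeeping HELPER for the crux K2 (route `KleimanBFSeeds`, registered stub
`stub_good : GoodAnchorPerDiscriminantClass` of `Cruxes/KleimanSemiregularAnchor/Lines/chosen_anchor.lean`). It proves
NOTHING toward K2, rung H2, HC_AV, HC_CM or HC, and constructs no sheaf. It retires, kernel-checked and for EVERY
`C : ChernCharacterBetti`, two degenerate candidate populations of the census of `stub_good` (units
leafhand-hodge-kleimanbf-1 / kleimanbfseeds-1 / -2 / -3: "(v4) zero or free module", "(v1) rank one with `1 ∈ I`"):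

* §1 `map_symmetrised_eq_smul` — the `K`-symmetrised class `h = d·x + ψ₀^*x` of ANY `x ∈ H²(P(ℂ); ℂ)` is
  `ψ₀`-compatible: `ψ₀^*h = d·h` (from `ψ₀ ≫ ψ₀ = -d` and `(-[d])^* = d²` on `H²`, the tree's
  `complexBetti_map_neg_nsmul_id_two`);
* §2 `smul_cupPowTwo_add_smul_not_mem_span` — for `w ≠ 0` in the Weil plane `weilClassesOf P ψ₀ 3 d` (`d ≥ 1`) and
  `N ≠ 0`, the seed's target class `q·h³ + N·w` is OFF the Lefschetz ray `ℂ·h³` (the tree's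
  `Ring2.SemiregularRepresentatives.eq_zero_of_mem_span_cupPowTwo_of_mem_weilClassesOf`: `ψ₀^*` scales the ray by
  `d³` and the Weil plane by `-d³`);
* §3 consequences for the Chern-character clause shared by `HasWeilClassDesignAt C 3 P h w` and
  `HasBFSheafSeedAt C 3 P h w` (`ch₃(E₀) ↦ q·h³ + N·w`, `N ≠ 0`, on a model `X₀ ≅ P.X`):
  `not_isZero_of_chThree_eq` — `E₀` is not a zero module (`ch(0) = 0` lies on the ray);
  `not_hasRankLE_one_of_chThree_eq_of_chOne_eq` — if moreover `ch₁(E₀) ↦ c·h` (the clause `p' = 1` of a seed with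
  `1 ∈ I`, or of every design) then `E₀` is not of rank `≤ 1`, by the exponential field
  `ch₃(L) = ch₁(L)³/3!` of `ChernCharacterBetti`, which would put `ch₃` on the ray;
  `hasBFSheafSeedAt_witness_not_junk` / `hasWeilClassDesignAt_witness_not_junk` — the packaged forms.
So the `I`-semiregular sheaf K2 asks for has rank `≥ 2` whenever `1 ∈ I` (complementing
`Theorems.isISemiregular_of_hasRank_one`, p798889: rank one IS `I`-semiregular for every `I ∋ 0` — semiregular,
but never a seed), and the only remaining rank-one window is `1 ∉ I` (e.g. `I = {3}`: `σ₂`-injectivity), where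
Buchweitz–Flenner's Thm. 5.1 itself forces `c₁ ∝ h` along the Weil Hodge locus (census (v1), not formalised).

References: [vanGeemen1994HodgeAV] 4.9, Lemma 5.2; [Fulton1998] §15.1 (iii) (`ch(L) = exp c₁(L)`);
[BuchweitzFlenner2003] §5 (the predicates); [MumfordAV1970] §19 (`[n]^*` on `H^k`).
-/

-- every declaration of this problem lives in `Summit.HodgeConjecture.HodgeConjecture.…` (summit = sub-problem)
set_option linter.dupNamespace false

noncomputable section

namespace Summit.HodgeConjecture.HodgeConjecture.Theorems

open CategoryTheory CategoryTheory.Limits AlgebraicGeometry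
open Literature.AlgebraicGeometry.Motives Literature.AlgebraicGeometry.HodgeTheory
open Literature.AlgebraicTopology.SingularHomology
open Summit.HodgeConjecture.HodgeConjecture.Ring2.SemiregularRepresentatives

variable {P : AbelianVariety ℂ} {ψ₀ : P ⟶ P} {d : ℕ}

/-! ### §1 The symmetrised class is `ψ₀`-compatible -/

/-- **`ψ₀^*(d·x + ψ₀^*x) = d·(d·x + ψ₀^*x)`** for `ψ₀ ≫ ψ₀ = -(d·𝟙)`: `ψ₀^*ψ₀^* = (ψ₀ ≫ ψ₀)^* = (-[d])^* = d²` on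
`H²(P(ℂ); ℂ)`. In particular the route's polarisation class `h(e, a) = d·e^*a + ψ₀^*e^*a` is `ψ₀`-compatible
(van Geemen's `E(kx, ky) = Nm(k)·E(x, y)`). [cite: vanGeemen1994HodgeAV, Lemma 5.2] [cite: MumfordAV1970, §19] -/
theorem map_symmetrised_eq_smul (hψ : ψ₀ ≫ ψ₀ = -(d • 𝟙 P)) (x : complexBetti P.X 2) :
    complexBetti.map ψ₀.hom.hom.hom 2 ((d : ℂ) • x + complexBetti.map ψ₀.hom.hom.hom 2 x) =
      (d : ℂ) • ((d : ℂ) • x + complexBetti.map ψ₀.hom.hom.hom 2 x) := by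
  rw [map_add, map_smul, ← complexBetti_map_comp_hom_apply ψ₀ ψ₀ 2 x, hψ,
    SegreHyperplaneClass.complexBetti_map_neg_nsmul_id_two P d x, smul_add, smul_smul, add_comm, ← pow_two]

/-! ### §2 The seed's target class is off the Lefschetz ray -/

/-- **`q·h³ + N·w ∉ ℂ·h³`** for `h = d·x + ψ₀^*x`, `w ≠ 0` in the Weil plane `weilClassesOf P ψ₀ 3 d`, `d ≥ 1`,
`ψ₀² = -d` and `N ≠ 0`: otherwise `N·w` would lie on the ray AND in the Weil plane, hence vanish (`ψ₀^*` acts by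
`d³` on the ray and by `(-d)³` on the plane). [cite: vanGeemen1994HodgeAV, 4.9 and Lemma 5.2] -/
theorem smul_cupPowTwo_add_smul_not_mem_span (hd : 0 < d) (hψ : ψ₀ ≫ ψ₀ = -(d • 𝟙 P))
    {w : complexBetti P.X (2 * 3)} (hw : w ∈ weilClassesOf P ψ₀ 3 d) (hw0 : w ≠ 0)
    (x : complexBetti P.X 2) (q : ℂ) {N : ℂ} (hN : N ≠ 0) :
    q • cupPowTwo ((d : ℂ) • x + complexBetti.map ψ₀.hom.hom.hom 2 x) 3 + N • w ∉
      (ℂ ∙ cupPowTwo ((d : ℂ) • x + complexBetti.map ψ₀.hom.hom.hom 2 x) 3) := by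
  intro hmem
  have hNw : N • w ∈ (ℂ ∙ cupPowTwo ((d : ℂ) • x + complexBetti.map ψ₀.hom.hom.hom 2 x) 3) := by
    have hsub := Submodule.sub_mem _ hmem (Submodule.smul_mem _ q (Submodule.mem_span_singleton_self _))
    rwa [add_sub_cancel_left] at hsub
  have hzero := eq_zero_of_mem_span_cupPowTwo_of_mem_weilClassesOf (A := P) (φ := ψ₀) (n := 3) (d := d)
    ⟨1, rfl⟩ hd (map_symmetrised_eq_smul hψ x) hNw (Submodule.smul_mem _ N hw)
  exact hw0 ((smul_eq_zero.1 hzero).resolve_left hN)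

/-! ### §3 Consequences for the Chern-character clause of designs and seeds -/

section Shape

variable {C : ChernCharacterBetti} {X₀ : SchemeOver ℂ} {E₀ : X₀.left.Modules} {w : complexBetti P.X (2 * 3)}
  {x : complexBetti P.X 2} {q N : ℚ}

/-- **The sheaf of the seed shape is not zero**: if `ch₃(E₀) ↦ q·h³ + N·w` under a model `eX : P.X ≅ X₀` with
`N ≠ 0`, `w ≠ 0` a Weil class, then `E₀` is not a zero module (`ch(0) = 0` is on the ray `ℂ·h³`).
[cite: Fulton1998, Example 3.2.3] [cite: vanGeemen1994HodgeAV, Lemma 5.2] -/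
theorem not_isZero_of_chThree_eq (hd : 0 < d) (hψ : ψ₀ ≫ ψ₀ = -(d • 𝟙 P))
    (hw : w ∈ weilClassesOf P ψ₀ 3 d) (hw0 : w ≠ 0) (eX : P.X ≅ X₀) (hN : N ≠ 0)
    (hch : complexBetti.map eX.hom (2 * 3) (C.ch X₀ E₀ 3) =
      ((q : ℚ) : ℂ) • cupPowTwo ((d : ℂ) • x + complexBetti.map ψ₀.hom.hom.hom 2 x) 3 + ((N : ℚ) : ℂ) • w) :
    ¬ IsZero E₀ := by
  intro hE
  have hN' : ((N : ℚ) : ℂ) ≠ 0 := by exact_mod_cast hN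
  refine smul_cupPowTwo_add_smul_not_mem_span hd hψ hw hw0 x ((q : ℚ) : ℂ) hN' ?_
  rw [← hch, C.ch_eq_zero_of_isZero hE 3, map_zero]
  exact Submodule.zero_mem _

/-- **The sheaf of the seed shape is not of rank `≤ 1` once `ch₁` is on the `h`-line**: if
`ch₃(E₀) ↦ q·h³ + N·w` (`N ≠ 0`, `w ≠ 0` Weil) and `ch₁(E₀) ↦ c·h`, then `¬ HasRankLE E₀ 1` — for a module of
rank `≤ 1` the exponential field gives `ch₃ = ch₁³/3! ↦ (c³/6)·h³`, on the ray. [cite: Fulton1998, §15.1 (iii)]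
[cite: vanGeemen1994HodgeAV, Lemma 5.2] -/
theorem not_hasRankLE_one_of_chThree_eq_of_chOne_eq (hd : 0 < d) (hψ : ψ₀ ≫ ψ₀ = -(d • 𝟙 P))
    (hw : w ∈ weilClassesOf P ψ₀ 3 d) (hw0 : w ≠ 0) (eX : P.X ≅ X₀) (hN : N ≠ 0)
    (hch : complexBetti.map eX.hom (2 * 3) (C.ch X₀ E₀ 3) =
      ((q : ℚ) : ℂ) • cupPowTwo ((d : ℂ) • x + complexBetti.map ψ₀.hom.hom.hom 2 x) 3 + ((N : ℚ) : ℂ) • w)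
    {c : ℂ} (hc₁ : complexBetti.map eX.hom (2 * 1) (C.ch X₀ E₀ 1) =
      c • cupPowTwo ((d : ℂ) • x + complexBetti.map ψ₀.hom.hom.hom 2 x) 1) :
    ¬ HasRankLE E₀ 1 := by
  intro hL
  have hN' : ((N : ℚ) : ℂ) ≠ 0 := by exact_mod_cast hN
  refine smul_cupPowTwo_add_smul_not_mem_span hd hψ hw hw0 x ((q : ℚ) : ℂ) hN' ?_
  rw [← hch, C.ch_of_hasRankLE_one hL (by norm_num : 0 < 3), map_smul, complexBetti_map_cupPowTwo']
  have h1 : complexBetti.map eX.hom 2 (C.ch X₀ E₀ 1) =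
      c • ((d : ℂ) • x + complexBetti.map ψ₀.hom.hom.hom 2 x) := by
    have := hc₁
    rwa [cupPowTwo_one] at this
  rw [h1, cupPowTwo_smul, smul_smul]
  exact Submodule.smul_mem _ _ (Submodule.mem_span_singleton_self _)

end Shape

/-! ### §4 Packaged: the witnesses of `HasBFSheafSeedAt` / `HasWeilClassDesignAt` are never junk -/

/-- **A Buchweitz–Flenner sheaf seed is never carried by a zero module, nor by a rank-`≤ 1` module when `1 ∈ I`**:
unpacking `HasBFSheafSeedAt C 3 P h w` at `h = d·x + ψ₀^*x` (`ψ₀² = -d ≤ -1`, `w ≠ 0` a Weil class) on any model.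
[cite: BuchweitzFlenner2003, §5] [cite: Fulton1998, §15.1 (iii)] [cite: vanGeemen1994HodgeAV, Lemma 5.2] -/
theorem hasBFSheafSeedAt_witness_not_junk (C : ChernCharacterBetti) (hd : 0 < d) (hψ : ψ₀ ≫ ψ₀ = -(d • 𝟙 P))
    {w : complexBetti P.X (2 * 3)} (hw : w ∈ weilClassesOf P ψ₀ 3 d) (hw0 : w ≠ 0) (x : complexBetti P.X 2)
    (hseed : HasBFSheafSeedAt C 3 P ((d : ℂ) • x + complexBetti.map ψ₀.hom.hom.hom 2 x) w)
    (X₀ : SchemeOver ℂ) (eX : P.X ≅ X₀) :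
    ∃ (I : Finset ℕ) (E₀ : X₀.left.Modules) (hE₀ : IsFiniteLocallyFree E₀) (q N : ℚ) (c : ℕ → ℚ),
      3 ∈ I ∧ N ≠ 0 ∧ IsISemiregular hE₀ {q' | q' + 1 ∈ I} ∧
      complexBetti.map eX.hom (2 * 3) (C.ch X₀ E₀ 3) =
        ((q : ℚ) : ℂ) • cupPowTwo ((d : ℂ) • x + complexBetti.map ψ₀.hom.hom.hom 2 x) 3 + ((N : ℚ) : ℂ) • w ∧
      (∀ p' ∈ I, p' ≠ 3 → complexBetti.map eX.hom (2 * p') (C.ch X₀ E₀ p') =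
        ((c p' : ℚ) : ℂ) • cupPowTwo ((d : ℂ) • x + complexBetti.map ψ₀.hom.hom.hom 2 x) p') ∧
      ¬ IsZero E₀ ∧ (1 ∈ I → ¬ HasRankLE E₀ 1) := by
  obtain ⟨I, E₀, hE₀, q, N, c, h3, hN, hsr, hch, hchp⟩ := hseed X₀ eX
  refine ⟨I, E₀, hE₀, q, N, c, h3, hN, hsr, hch, hchp, not_isZero_of_chThree_eq hd hψ hw hw0 eX hN hch,
    fun h1 => ?_⟩
  exact not_hasRankLE_one_of_chThree_eq_of_chOne_eq hd hψ hw hw0 eX hN hch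
    (c := ((c 1 : ℚ) : ℂ)) (hchp 1 h1 (by norm_num))

/-- **A class design is never carried by a zero module or a rank-`≤ 1` module** (its `ch₁` is on the `h`-line by
definition): unpacking `HasWeilClassDesignAt C 3 P h w` at `h = d·x + ψ₀^*x` (`ψ₀² = -d ≤ -1`, `w ≠ 0` Weil).
[cite: Fulton1998, Example 15.3.2 and §15.1 (iii)] [cite: vanGeemen1994HodgeAV, Lemma 5.2] -/
theorem hasWeilClassDesignAt_witness_not_junk (C : ChernCharacterBetti) (hd : 0 < d)
    (hψ : ψ₀ ≫ ψ₀ = -(d • 𝟙 P)) {w : complexBetti P.X (2 * 3)} (hw : w ∈ weilClassesOf P ψ₀ 3 d) (hw0 : w ≠ 0)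
    (x : complexBetti P.X 2)
    (hdes : HasWeilClassDesignAt C 3 P ((d : ℂ) • x + complexBetti.map ψ₀.hom.hom.hom 2 x) w)
    (X₀ : SchemeOver ℂ) (eX : P.X ≅ X₀) :
    ∃ (E₀ : X₀.left.Modules) (_ : IsFiniteLocallyFree E₀) (q N : ℚ) (c : ℕ → ℚ), N ≠ 0 ∧
      complexBetti.map eX.hom (2 * 3) (C.ch X₀ E₀ 3) =
        ((q : ℚ) : ℂ) • cupPowTwo ((d : ℂ) • x + complexBetti.map ψ₀.hom.hom.hom 2 x) 3 + ((N : ℚ) : ℂ) • w ∧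
      (∀ p : ℕ, 0 < p → p < 3 → complexBetti.map eX.hom (2 * p) (C.ch X₀ E₀ p) =
        ((c p : ℚ) : ℂ) • cupPowTwo ((d : ℂ) • x + complexBetti.map ψ₀.hom.hom.hom 2 x) p) ∧
      ¬ IsZero E₀ ∧ ¬ HasRankLE E₀ 1 := by
  obtain ⟨E₀, hE₀, q, N, c, hN, hch, hchp⟩ := hdes X₀ eX
  exact ⟨E₀, hE₀, q, N, c, hN, hch, hchp, not_isZero_of_chThree_eq hd hψ hw hw0 eX hN hch,
    not_hasRankLE_one_of_chThree_eq_of_chOne_eq hd hψ hw hw0 eX hN hch (c := ((c 1 : ℚ) : ℂ))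
      (hchp 1 (by norm_num) (by norm_num))⟩

end Summit.HodgeConjecture.HodgeConjecture.Theorems

end
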